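import Summits.BirchSwinnertonDyer.Rank1Residual.Additive.DisegniLineGrossZagier
import Summits.BirchSwinnertonDyer.Rank1Residual.Additive.DisegniLineEndStateInputs
import Summits.BirchSwinnertonDyer.Rank1Residual.Additive.DisegniLineTwistData
import Summits.BirchSwinnertonDyer.Rank1Residual.Additive.TwistedBranchPAdicGrossZagierEndStateIntrinsic
import Literature.NumberTheory.EllipticCurves.Disegni2017.CycLineGrossZagierFact
import Literature.NumberTheory.EllipticCurves.NonvanishingTwists
import Literature.NumberTheory.EllipticCurves.BSDRootNumberModularityOnlyProofs
import Literature.NumberTheory.EllipticCurves.BSDSelmerParityDokchitserBaseChangeProofs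
import Literature.NumberTheory.EllipticCurves.AnalyticRankOrderProofs
import Literature.FieldTheory.AlgClosed.PadicAlgClEquivComplex
import HarnessLib

/-!
# STEP C(3) of the kernel derivation of `hFact`: X3♯(G-ord) ∩ `I₀*`, rank one — `BSD(E,p)` with the cell's
# reading fact `hFact` REPLACED by published facts (cell `bsd-addord`, seat `bsd-addord-gz` gen 4)

HONEST FRAMING (cell `bsd-addord`; PARTITION (D-0054): EXCLUDED-DOMAIN additive rows §E (B6 = O7-ord r1):
X3♯(G-ord, e = 2) ∩ `I₀*` ∩ r_an = 1 ∩ ¬CM ∩ non-anomalous ∩ branch-parity line position × p ≡ 1 (mod 4),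
p ≥ 5 — types-the-object-of per (E,p), closes none by itself; booked 0 until instantiated row by row).
THEOREMS ONLY. This is `ClassX3Gord.bsdp_rankOne_of_facts_of_delbourgoDatumFact_of_branchCoeffOneNeZero`
(TwistedBranchPAdicGrossZagierEndState) with the seat's reading fact
`Disegni2017.delbourgoDatum_rankOne_leadingTerms` (hFact) REPLACED by: lit's conjoined named fact (B)
`Disegni2017.delbourgoDatum_cycLineGrossZagier` (Disegni 2017 Thm. A on the line + Thm. B ÷ (1.1.3) at
`𝟙_K` for Delbourgo's datum; p409418/p409745), the Artin formalism `hArt` (lit p408789), Gross–Zagier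
I.(7.3) `h73`, Waldspurger's non-vanishing twist with prescribed splitting `hWald`, modularity
(`hmod`, `hmodD`, `hmodN`) and GZK `hGZK` — through the seat's KERNEL THEOREMS STEP A–C
(`DisegniLineValues`, `…Pointwise`, `…LeadingCoeff`, `…Descent`, `…GrossZagier`, `…TwistData`,
`…EndStateInputs`, `KroneckerTwistCoeff`). The remaining non-published input is the analytic number
`BranchCoeffOneNeZeroAt W p` (certified per row, `HOME/proof/gz4/`).

References: [Disegni2017] Thm. A, Thm. B, (1.1.3); [Delbourgo2002] Thm. (A), (B); [GrossZagier1986]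
Thm. I.(7.3); [Darmon2004] §3.9 (Waldspurger); [Wuthrich2014] Thm. 16; [GreenbergVatsal2000] Thm. (3.12);
[Pal2012] Thm. 3.2; [MazurTateTeitelbaum1986Invent] §I.14.
-/

set_option autoImplicit false

noncomputable section

open scoped Classical MatrixGroups ModularForm NumberField

open CongruenceSubgroup WeierstrassCurve NumberField IsDedekindDomain Field
  Literature.NumberTheory.EllipticCurves Literature.NumberTheory.EllipticCurves.ModularForms
  Literature.NumberTheory.EllipticCurves.GreenbergVatsal2000
  Literature.NumberTheory.EllipticCurves.Rank1Residual
  Literature.NumberTheory.EllipticCurves.Rank1Residual.Typed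
  Literature.NumberTheory.EllipticCurves.Delbourgo2002
  Literature.NumberTheory.EllipticCurves.Disegni2017
  Literature.NumberTheory.GaloisRepresentations
  Summit.BirchSwinnertonDyer.Rank1Residual.AdditivePotMult
  Summit.BirchSwinnertonDyer.Rank1Residual.Additive.X3Branch

namespace Summit.BirchSwinnertonDyer.Rank1Residual.Additive

variable {W : WeierstrassCurve ℚ} [W.IsElliptic] [W.IsGloballyMinimal] {p : ℕ} [hp : Fact p.Prime]

/-- **X3♯(G-ord) ∩ `I₀*` (`E[p]` reducible, `e = 2`), `p ≡ 1 (mod 4)`, `p ≥ 5`, `E` non-CM,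
`r_an(E) = 1`, non-anomalous, branch-parity line position: `BSD(E,p)` from PUBLISHED named facts + ONE
analytic number**, the reading fact `hFact` of the predecessor theorem replaced by lit's conjoined fact
(B) `hCyc` + `hArt` + `h73` + `hWald` + modularity, via the kernel theorems STEP A–C. Chain: K from
`hWald` (Heegner field with `L(E^{(d_K)},1) ≠ 0`); the datum `(Dh, DhK)` from `hCyc`; twist data
(`exists_twist_newform`, `legendrePlusSymbolSum_ne_zero_of_twist`); the identity at `(V, f, ϖ)`
(`branchPAdicGrossZagier_identity_of_cycLine`); Schneider (§C(3a)); lower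
(`cycLowerBoundAt_of_chiBranchLower_of_identity` + `missingLowerBoundAt_of_cycLowerBound`); upper
(`ClassX3Gord.missingUpperBoundAt_rankOne_of_wuthrichHalf_of_identity`); glue. Nothing booked.
[cite: Disegni2017, Theorem A (arXiv v3 PDF pp. 7–8), Theorem B (PDF p. 9), (1.1.3) (PDF pp. 4–5)]
[cite: Delbourgo2002, Theorem (A), (B) (p. 40)] [cite: GrossZagier1986, Thm. I.(7.3)]
[cite: Darmon2004, §3.9, proof of Thm. 3.22] [cite: Wuthrich2014, Thm. 16 (p. 397)]
[cite: GreenbergVatsal2000, §3 Thm. (3.12) p. 45] [cite: Pal2012, Thm. 3.2] [cite: Miller2011LMS, Def. 1.1] -/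
theorem ClassX3Gord.bsdp_rankOne_of_facts_of_cycLineFact_of_branchCoeffOneNeZero
    (hW16 : Wuthrich2014.thm16_halfEigenCharIdeal_dvd_cyclotomicPrime)
    (hGV : thm312_branch_unitContent_and_lambda_eq_residual_goodOrd)
    (h23 : datumSelmer_nonPrimitive_invariants)
    (h414 : Greenberg1999.prop414_noFiniteSubmodule_of_not_dvd_torsionOrder)
    (hGrK : Greenberg1999.imKummer_ge_strictCondition_goodOrdinary)
    (hLiftF : residualEpsilon_surjOn_of_lineRamifiedEven)
    (hCyc : delbourgoDatum_cycLineGrossZagier)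
    (hArt : rankinSelbergEulerProductHecke_baseChangeDirichlet_eq) (h73 : GrossZagier1986_thm_I_7_3)
    (hWald : waldspurger_exists_heegnerField_twist_ne_zero)
    (hDel : Delbourgo2002.mainTheorem) (hmod : hasEntireLFunction_rat)
    (hmodD : nonempty_modularParametrizationData) (hmodN : exists_isNewformOf)
    (hGZK : rank_eq_analyticRank_of_analyticRank_le_one)
    (hX : ClassX3Gord W p) (he : semistabilityIndex W p = 2) (hp4 : p % 4 = 1) (hcm : ¬ W.HasCM)
    (hna : ReductionNonAnomalous W p) (hr : W.analyticRank = 1)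
    (Φ₀ : AddSubgroup (W.geomTorsion (p : ℤ))) (hΦ : IsRationalLine W p Φ₀)
    (hram0 : ¬ LineUnramifiedAt W p Φ₀) (heven : LineEven W p Φ₀)
    (hram : ∀ (K : Type) [Field K] [NumberField K] [(galRange (K := ℚ) K).Normal],
      Module.finrank ℚ K = 2 → (∃ θ : K, θ ^ 2 = algebraMap ℚ K ((-1) ^ (p / 2) * p)) →
      ¬ ∀ v : HeightOneSpectrum (𝓞 ℚ), ((p : ℕ) : 𝓞 ℚ) ∈ v.asIdeal →
        ∀ 𝔓 ∈ v.primesAbove, ∀ σ ∈ 𝔓.inertia (absoluteGaloisGroup ℚ), ∀ P ∈ Φ₀,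
          σ • P = (if σ ∈ galRange (K := ℚ) K then P else -P))
    (hne : BranchCoeffOneNeZeroAt W p) : BSDp W p := by
  have hpP : p.Prime := hp.out
  have hp2 : p ≠ 2 := by omega
  have hp5 : 5 ≤ p := by have := hpP.two_le; omega
  have hev : Even (p / 2) := ⟨p / 4, by omega⟩
  -- (L) from published facts + the line data
  obtain ⟨S₀, hS₀, hS⟩ := X2.GreenbergVatsalCaseOne.exists_finset_bad_not_mem W p
  have hdiv : ChiBranchLowerDivisibilityAt W p :=
    X3Branch.chiBranchLowerDivisibilityAt_of_facts hW16 hGV h23 h414 hGrK hLiftF S₀ hS₀ hS Φ₀ hΦ hram0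
      heven hram
  -- the twist model, its newform and period ratio; the newform of `E`
  obtain ⟨V, iV, iVm, C, hV, hC⟩ := hX.exists_goodOrd_pStar_twist_model W p hp2 he
  have hps : ((-1 : ℚ) ^ (p / 2) * (p : ℚ)) = (p : ℚ) := by rw [hev.neg_one_pow, one_mul]
  have hVW : ∃ C : VariableChange ℚ, C • V.quadraticTwist (p : ℚ) = W := ⟨C, by rw [← hps]; exact hC⟩
  have hordin : IsOrdinaryAt V p := ⟨hV.1, hV.2⟩
  haveI : NeZero (V.conductorNorm ℤ) := ⟨(V.conductorNorm_pos_holds).ne'⟩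
  obtain ⟨Dm⟩ := hmodD V
  obtain ⟨ϖ, -, hϖ, -⟩ := Dm.exists_rat_mul_realPeriodRat_eq_plusPeriod
  haveI : NeZero (W.conductorNorm ℤ) := ⟨(W.conductorNorm_pos_holds).ne'⟩
  obtain ⟨DmW⟩ := hmodD W
  -- the Heegner field with `L(E^{(d_K)}, 1) ≠ 0` (Waldspurger)
  have hroot : W.rootNumber = -1 := by
    rcases rootNumber_eq_one_or_eq_neg_one W with h1 | h1
    · exfalso
      have hev1 : Even W.analyticRank :=
        (even_analyticRank_iff_rootNumber_eq_one_of_exists_isNewformOf W hmodN).mpr h1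
      rw [hr] at hev1
      exact Nat.not_even_one hev1
    · exact h1
  obtain ⟨K, _, _, hK, -, hHeeg, hLd⟩ := hWald W hroot 0
  have h2 : Module.finrank ℚ K = 2 := hK.1
  haveI : IsGalois ℚ K := isGalois_of_finrank_eq_two K h2
  have hdq : (NumberField.discr K : ℚ) ≠ 0 := by exact_mod_cast NumberField.discr_ne_zero K
  -- the Kronecker character and the twist data
  obtain ⟨κ, hκ, hκ2, hκall⟩ := exists_kroneckerChar_twistCoeff K h2
  obtain ⟨hpd, hκW, V', iV', iVm', N', _, f', hfV', hV', hap, hordV'⟩ :=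
    exists_twist_newform K hmodD hmodN hp4 h2 κ hκ hκall hHeeg hX.addv V hVW hV Dm.isNewformOf
  have hpdN : Nat.Coprime p (NumberField.discr K).natAbs :=
    (Nat.Prime.coprime_iff_not_dvd hpP).mpr fun h ↦ hpd (Int.natCast_dvd.mpr h)
  have hS' : legendrePlusSymbolSum f' p ≠ 0 :=
    legendrePlusSymbolSum_ne_zero_of_twist K hmod hp4 κ hκW hX.addv V hVW Dm.isNewformOf hfV'.1
      hfV'.coeffField_eq_bot hV' hLd
  have hrd : (W.quadraticTwist (NumberField.discr K : ℚ)).mordellWeilRank = 0 := by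
    haveI := W.isElliptic_quadraticTwist hdq
    have h0 : (W.quadraticTwist (NumberField.discr K : ℚ)).analyticRank = 0 :=
      (analyticRank_eq_zero_iff_holds (hmod _)).mpr hLd
    rw [(hGZK _ (by rw [h0]; exact zero_le_one)).1, h0]
  -- the datum: lit's conjoined fact (B)
  obtain ⟨ι⟩ := PadicAlgCl.nonempty_ringEquiv_complex (p := p)
  have hpstar : ((pStar p : ℤ) : ℚ) = (-1 : ℚ) ^ (p / 2) * p := by
    rw [pStar, show (p - 1) / 2 = p / 2 by omega]
    push_cast
    ring
  have hCps : C • V.quadraticTwist (pStar p : ℚ) = W := by rw [hpstar]; exact hC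
  obtain ⟨Dh, DhK, hres, hB, hGZc⟩ := hCyc.exists_datum ι hp2 hcm hX.addv hr (Or.inl ⟨hp5, hX.typeGOrd⟩)
    hCps (Or.inl ⟨hV.1, hordin, rfl⟩) DmW.isNewformOf hK hHeeg
  -- STEP C(2): the identity at `(V, f, ϖ)`
  obtain ⟨u, q, hlead, hpgz⟩ := branchPAdicGrossZagier_identity_of_cycLine ι K hp4 hArt h73
    Pal2012.thm32_sqrt_mul_realPeriodRat_twist_eq_of_prime_one_mod_four_holds hmod hGZK h2 κ hκ hκ2
    hpdN hrd hX.addv hr V V' hVW hV hordV' hap Dm.isNewformOf DmW.isNewformOf hfV' hV' hS' ϖ hϖ hres hGZc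
  -- (S), lower half, upper half, glue
  have hSch : SchneiderConjecture Dh :=
    schneiderConjecture_of_identity_of_branchCoeffOneNeZero hp4 hne V C hC hordin Dm.f Dm.isNewformOf ϖ
      hϖ hpgz
  have hlow : CycLowerBoundAt W p Dh :=
    cycLowerBoundAt_of_chiBranchLower_of_identity W p
      Pal2012.thm32_sqrt_mul_realPeriodRat_twist_eq_of_prime_one_mod_four_holds hmod hGZK hX.addv hr hp4
      V hVW hV Dm.isNewformOf ϖ hϖ hdiv hlead hpgz
  have hl : MissingLowerBoundAt W p :=
    missingLowerBoundAt_of_cycLowerBound W p hB hSch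
      (fun κ' γ hκ' hγ D ↦ hDel.isTorsion hp5 hcm hX.addv hX.typeGOrd hκ' hγ D) hGZK (by rw [hr]) hna hlow
  have hu : MissingUpperBoundAt W p :=
    ClassX3Gord.missingUpperBoundAt_rankOne_of_wuthrichHalf_of_identity hW16 hGZK hmod hX hp4 hr hB hSch
      V hV C hC Dm.isNewformOf ϖ hϖ hlead hpgz
  exact bsdp_of_missingPPartAt W p hGZK (by rw [hr]) (missingPPartAt_of_lower_of_upper W p hl hu)

/-- **X3♯(G-ord) ∩ `I₀*`, `p ≡ 1 (mod 4)`, `p ≥ 5`, `E` non-CM, `r_an(E) = 1`, branch-parity line position,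
ANOMALOUS OR NOT: `BSD(E,p)` from PUBLISHED named facts + ONE analytic number** — the twist seat's
hna-free end state `ClassX3Gord.bsdp_rankOne_of_facts_of_delbourgoDatumIntrinsic_of_branchCoeffOneNeZero`
(S6, p411060) with its `(B♮)`-currency datum `hDatum` REPLACED by lit's conjoined fact (B) `hCyc`
(`exists_datum_intrinsic`: both currencies of Delbourgo's Thm. (B) + Disegni's clauses) + `hArt` + `h73` +
`hWald` + `hmodN`, via the kernel theorems STEP A–C, exactly as in the previous theorem; Mazur 1972
Cor. 5.15 (`hMaz`) supplies the two unit factors at the place over `p` (twist seat (T3)). Nothing booked.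
[cite: Disegni2017, Theorem A (arXiv v3 PDF pp. 7–8), Theorem B (PDF p. 9), (1.1.3) (PDF pp. 4–5)]
[cite: Delbourgo2002, Theorem (B) (p. 40), p. 67 (iv), p. 69] [cite: Mazur1972, Cor. 5.15]
[cite: GrossZagier1986, Thm. I.(7.3)] [cite: Darmon2004, §3.9, proof of Thm. 3.22]
[cite: Wuthrich2014, Thm. 16 (p. 397)] [cite: GreenbergVatsal2000, §3 Thm. (3.12) p. 45] [cite: Pal2012, Thm. 3.2] -/
theorem ClassX3Gord.bsdp_rankOne_of_facts_of_cycLineFact_intrinsic_of_branchCoeffOneNeZero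
    (hW16 : Wuthrich2014.thm16_halfEigenCharIdeal_dvd_cyclotomicPrime)
    (hGV : thm312_branch_unitContent_and_lambda_eq_residual_goodOrd)
    (h23 : datumSelmer_nonPrimitive_invariants)
    (h414 : Greenberg1999.prop414_noFiniteSubmodule_of_not_dvd_torsionOrder)
    (hGrK : Greenberg1999.imKummer_ge_strictCondition_goodOrdinary)
    (hLiftF : residualEpsilon_surjOn_of_lineRamifiedEven)
    (hMaz : Mazur1972.cor515_universalNormIndex)
    (hCyc : delbourgoDatum_cycLineGrossZagier)
    (hArt : rankinSelbergEulerProductHecke_baseChangeDirichlet_eq) (h73 : GrossZagier1986_thm_I_7_3)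
    (hWald : waldspurger_exists_heegnerField_twist_ne_zero)
    (hDel : Delbourgo2002.mainTheorem) (hmod : hasEntireLFunction_rat)
    (hmodD : nonempty_modularParametrizationData) (hmodN : exists_isNewformOf)
    (hGZK : rank_eq_analyticRank_of_analyticRank_le_one)
    (hX : ClassX3Gord W p) (he : semistabilityIndex W p = 2) (hp4 : p % 4 = 1) (hcm : ¬ W.HasCM)
    (hr : W.analyticRank = 1)
    (Φ₀ : AddSubgroup (W.geomTorsion (p : ℤ))) (hΦ : IsRationalLine W p Φ₀)
    (hram0 : ¬ LineUnramifiedAt W p Φ₀) (heven : LineEven W p Φ₀)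
    (hram : ∀ (K : Type) [Field K] [NumberField K] [(galRange (K := ℚ) K).Normal],
      Module.finrank ℚ K = 2 → (∃ θ : K, θ ^ 2 = algebraMap ℚ K ((-1) ^ (p / 2) * p)) →
      ¬ ∀ v : HeightOneSpectrum (𝓞 ℚ), ((p : ℕ) : 𝓞 ℚ) ∈ v.asIdeal →
        ∀ 𝔓 ∈ v.primesAbove, ∀ σ ∈ 𝔓.inertia (absoluteGaloisGroup ℚ), ∀ P ∈ Φ₀,
          σ • P = (if σ ∈ galRange (K := ℚ) K then P else -P))
    (hne : BranchCoeffOneNeZeroAt W p) : BSDp W p := by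
  have hpP : p.Prime := hp.out
  have hp2 : p ≠ 2 := by omega
  have hp5 : 5 ≤ p := by have := hpP.two_le; omega
  have hev : Even (p / 2) := ⟨p / 4, by omega⟩
  -- (L) from published facts + the line data
  obtain ⟨S₀, hS₀, hS⟩ := X2.GreenbergVatsalCaseOne.exists_finset_bad_not_mem W p
  have hdiv : ChiBranchLowerDivisibilityAt W p :=
    X3Branch.chiBranchLowerDivisibilityAt_of_facts hW16 hGV h23 h414 hGrK hLiftF S₀ hS₀ hS Φ₀ hΦ hram0
      heven hram
  -- the twist model, its newform and period ratio; the newform of `E`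
  obtain ⟨V, iV, iVm, C, hV, hC⟩ := hX.exists_goodOrd_pStar_twist_model W p hp2 he
  have hps : ((-1 : ℚ) ^ (p / 2) * (p : ℚ)) = (p : ℚ) := by rw [hev.neg_one_pow, one_mul]
  have hVW : ∃ C : VariableChange ℚ, C • V.quadraticTwist (p : ℚ) = W := ⟨C, by rw [← hps]; exact hC⟩
  have hordin : IsOrdinaryAt V p := ⟨hV.1, hV.2⟩
  haveI : NeZero (V.conductorNorm ℤ) := ⟨(V.conductorNorm_pos_holds).ne'⟩
  obtain ⟨Dm⟩ := hmodD V
  obtain ⟨ϖ, -, hϖ, -⟩ := Dm.exists_rat_mul_realPeriodRat_eq_plusPeriod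
  haveI : NeZero (W.conductorNorm ℤ) := ⟨(W.conductorNorm_pos_holds).ne'⟩
  obtain ⟨DmW⟩ := hmodD W
  -- the Heegner field with `L(E^{(d_K)}, 1) ≠ 0` (Waldspurger)
  have hroot : W.rootNumber = -1 := by
    rcases rootNumber_eq_one_or_eq_neg_one W with h1 | h1
    · exfalso
      have hev1 : Even W.analyticRank :=
        (even_analyticRank_iff_rootNumber_eq_one_of_exists_isNewformOf W hmodN).mpr h1
      rw [hr] at hev1
      exact Nat.not_even_one hev1
    · exact h1
  obtain ⟨K, _, _, hK, -, hHeeg, hLd⟩ := hWald W hroot 0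
  have h2 : Module.finrank ℚ K = 2 := hK.1
  haveI : IsGalois ℚ K := isGalois_of_finrank_eq_two K h2
  have hdq : (NumberField.discr K : ℚ) ≠ 0 := by exact_mod_cast NumberField.discr_ne_zero K
  -- the Kronecker character and the twist data
  obtain ⟨κ, hκ, hκ2, hκall⟩ := exists_kroneckerChar_twistCoeff K h2
  obtain ⟨hpd, hκW, V', iV', iVm', N', _, f', hfV', hV', hap, hordV'⟩ :=
    exists_twist_newform K hmodD hmodN hp4 h2 κ hκ hκall hHeeg hX.addv V hVW hV Dm.isNewformOf
  have hpdN : Nat.Coprime p (NumberField.discr K).natAbs :=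
    (Nat.Prime.coprime_iff_not_dvd hpP).mpr fun h ↦ hpd (Int.natCast_dvd.mpr h)
  have hS' : legendrePlusSymbolSum f' p ≠ 0 :=
    legendrePlusSymbolSum_ne_zero_of_twist K hmod hp4 κ hκW hX.addv V hVW Dm.isNewformOf hfV'.1
      hfV'.coeffField_eq_bot hV' hLd
  have hrd : (W.quadraticTwist (NumberField.discr K : ℚ)).mordellWeilRank = 0 := by
    haveI := W.isElliptic_quadraticTwist hdq
    have h0 : (W.quadraticTwist (NumberField.discr K : ℚ)).analyticRank = 0 :=
      (analyticRank_eq_zero_iff_holds (hmod _)).mpr hLd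
    rw [(hGZK _ (by rw [h0]; exact zero_le_one)).1, h0]
  -- the datum, in both currencies: lit's conjoined fact (B)
  obtain ⟨ι⟩ := PadicAlgCl.nonempty_ringEquiv_complex (p := p)
  have hpstar : ((pStar p : ℤ) : ℚ) = (-1 : ℚ) ^ (p / 2) * p := by
    rw [pStar, show (p - 1) / 2 = p / 2 by omega]
    push_cast
    ring
  have hCps : C • V.quadraticTwist (pStar p : ℚ) = W := by rw [hpstar]; exact hC
  obtain ⟨Dh, DhK, hres, hBι, hB, hGZc⟩ := hCyc.exists_datum_intrinsic ι hp5 hcm hX.addv hX.typeGOrd hr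
    hCps (Or.inl ⟨hV.1, hordin, rfl⟩) DmW.isNewformOf hK hHeeg
  -- the two unit factors at the place over `p` (Mazur 1972 via the twist transport)
  set v₀ : HeightOneSpectrum (𝓞 ℚ) := (Rat.HeightOneSpectrum.primesEquiv (R := 𝓞 ℚ)).symm ⟨p, hp.out⟩
    with hv₀_def
  have hv₀ : (p : 𝓞 ℚ) ∈ v₀.asIdeal := natCast_mem_asIdeal_of_primesEquiv_eq (primesEquiv_symm_apply_coe p)
  have hcp0 : W.tamagawaNumberAt v₀ ≠ 0 := (tamagawaNumberAt_ne_zero_and_le_four_of_addv W p hX.addv).1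
  have hι : ∀ κ : ZpExtension ℚ p, κ.IsCyclotomic →
      localUniversalNormIndex (W := W) (v₀.adicCompletion ℚ) κ ⊤ ≠ 0 →
      ¬ p ∣ localUniversalNormIndex (W := W) (v₀.adicCompletion ℚ) κ ⊤ :=
    fun κ hκ h0 ↦ hX.not_dvd_localUniversalNormIndex_of_facts hMaz hp2 he κ hκ v₀ hv₀ h0
  -- STEP C(2): the identity at `(V, f, ϖ)`
  obtain ⟨u, q, hlead, hpgz⟩ := branchPAdicGrossZagier_identity_of_cycLine ι K hp4 hArt h73
    Pal2012.thm32_sqrt_mul_realPeriodRat_twist_eq_of_prime_one_mod_four_holds hmod hGZK h2 κ hκ hκ2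
    hpdN hrd hX.addv hr V V' hVW hV hordV' hap Dm.isNewformOf DmW.isNewformOf hfV' hV' hS' ϖ hϖ hres hGZc
  -- (S), lower half (intrinsic currency), upper half, glue
  have hSch : SchneiderConjecture Dh :=
    schneiderConjecture_of_identity_of_branchCoeffOneNeZero hp4 hne V C hC hordin Dm.f Dm.isNewformOf ϖ
      hϖ hpgz
  have hlow : CycLowerBoundAt W p Dh :=
    cycLowerBoundAt_of_chiBranchLower_of_identity W p
      Pal2012.thm32_sqrt_mul_realPeriodRat_twist_eq_of_prime_one_mod_four_holds hmod hGZK hX.addv hr hp4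
      V hVW hV Dm.isNewformOf ϖ hϖ hdiv hlead hpgz
  have hl : MissingLowerBoundAt W p :=
    missingLowerBoundAt_of_cycLowerBound_of_not_dvd_index W p hBι hSch
      (fun κ' γ hκ' hγ D ↦ hDel.isTorsion hp5 hcm hX.addv hX.typeGOrd hκ' hγ D) hGZK (by rw [hr]) v₀ hv₀
      hcp0 hι hlow
  have hu : MissingUpperBoundAt W p :=
    ClassX3Gord.missingUpperBoundAt_rankOne_of_wuthrichHalf_of_identity hW16 hGZK hmod hX hp4 hr hB hSch
      V hV C hC Dm.isNewformOf ϖ hϖ hlead hpgz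
  exact bsdp_of_missingPPartAt W p hGZK (by rw [hr]) (missingPPartAt_of_lower_of_upper W p hl hu)

end Summit.BirchSwinnertonDyer.Rank1Residual.Additive

end
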